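import Literature.MathematicalPhysics.QuantumFieldTheory.Balaban1983to89.Node00.CarriersYUPar
import Literature.MathematicalPhysics.QuantumFieldTheory.Balaban1983to89.B9SectBCodedReadingsUParH

/-!
# NODE 00 — THE [B9] CARRIER BUNDLE OVER THE CODED CARRIER WITH THE TWO SITE TRANSPORTERS SEPARATED (averaging `parA`, Hölder `parH`) AND THE
# BOND-AVERAGE LETTER AS PARAMETERS: `carriersYUParH`, `Y9OfRecordUParH`, `Y9OfRecordUPbParH` (CASCADE-K, piece K0, edition 2) — Balaban, Commun. Math.
# Phys. **99** (1985) 389–434, Thm 3.4 p.400, (3.21) p.394, (3.40) p.397, (3.37)–(3.38) p.396, (3.115) p.418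

[cite: Balaban1985BackgroundPropagators, Thm 3.4 p.400 («extend … as analytic functions of A»), (3.21) p.394 (the averaging contours), (3.40) p.397 (the shortest
contours of the Hölder quotients), (3.37)–(3.38) p.396, Thm 3.2 (3.48) p.398, (3.42)–(3.47) pp.397–398, (3.84)–(3.86) p.407, Cor. 3.6 p.408, (3.115) p.418,
Thms 3.1–3.15 pp.397–432 (the carriers)] [cite: Balaban1985Averaging, Prop. 2 p.26 (the knit contour variables)]

Cell `pub-ymgap`, seat `pub-ymgap-node00-def-Y` (g32).  WHY THIS FILE (director-ym №383 «GO CASCADE-K»; dag-n06-c g23's ⚑ FLAG K1-PAR and its module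
`B9SectBCodedReadingsUParH` (`KSCUPar`), fleet INBOX 2026-08-30).  In edition 1, `carriersYUPar … par OA ops` (`Node00.CarriersYUPar`), ONE site transporter
`par` plays TWO printed roles: the AVERAGING contours of (3.21) inside `G′ = GpY par`, `C = CY par (GpY par)` and the analyticity slot, and the transporter of
the HÖLDER readings (3.43) ∕ (3.45) — which in print ride the SHORTEST contours (3.40) whatever the averaging contours are; at the knit letter `parKnitY` (equal
to `1` off corner pairs) the Hölder role is not a class law.  This ADDITIVE edition separates the two roles exactly as dag-n06-c's `KSCUPar … parA parH`:

* §2 ★★★ `carriersYUParH P G f b ιB C38 parA parH OA ops` — `carriersYUPar` verbatim except `G′ := KSCUPar … (parA j) (parH j) …`; `C⁻¹ := pullS … (CinvY P f G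
  parA j)` and analyticity `IsAnKY … (parA j) b …` read the averaging family; ★ `carriersYUPar_eq_carriersYUParH : carriersYUPar … par OA ops = carriersYUParH … par
  par OA ops` (`rfl`: edition 1 is the DIAGONAL instance, dag-n06-c's `KSCU_eq_KSCUPar`) and `carriersYU_eq_carriersYUParH` (today's bundle = the instance at
  `(parSymY, parSymY, GAY …)`); the faces of `CarriersYUPar` §2a–§2c re-read (`rfl` ∕ `Iff.rfl`).
* §3 at the record (`M_N(ℂ)`, `SU(N)`): `Y9OfRecordUParH N θ Mstar P ops f b ιB C38 parA parH OA` and, at the record's reading of print's class `P := extraYPb`,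
  `Y9OfRecordUPbParH N θ Mstar ops f b ιB C38 parA parH OA`, with `Y9OfRecordU[Par]_eq_Y9OfRecordUParH`, `Y9OfRecordUPb[Par]_eq_Y9OfRecordUPbParH` (`rfl`) and the
  faces.  The KNIT instance of record is `(parA, parH) := (parKnitY, parSymY)` over def-Y's `opsYNuStOfRecordV11KHE` (`Node00.OpsYRecordV11H`), whose
  `…_GpPin ∕ _GAPin ∕ _CinvPin` are a leaf's three pins in exactly this split shape.

HONEST STATUS.  Definitions by field assignment and `rfl` ∕ `Iff.rfl` faces over landed readings; nothing about Theorems 3.1–3.15 is proved here; no leaf is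
re-targeted here (dag-n06-d owns the leaf over the bundle); count-neutral.  0 `sorry`.
-/

noncomputable section

namespace Literature.MathematicalPhysics.QuantumFieldTheory.Balaban1983to89.Node00

open DagBinding (PrintedCarriers9X)
open B9PinCarriersKLevelV1 (OperatorLayerY)
open B9PinMembersKLevelV1 (MemberY geo9Y bg9Y)
open B9BackgroundsKLevelV1P (bg9KP)
open B9BackgroundsKLevelV1R (bg9YR kernelFamilyR kernelFamilyRY siteKernelR fineKernelR rwExpansionR rwKernelExpansionR hKernelR hKernelRY)
open B9SectBCodedClassR (RegExtraY regC335 regC336 bg9YC extraY extraYPb)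
open B9SectBGpLettersY (GVal)
open B9PinGeometryKLevelV1 (dOmegaY OmKY inΛY unitDistY InCubeY c35Y)
open B9Eq360DeltaPrimeAY (AfldY)
open B9SectBCodedCarrier (CCfg Coding pullK pullS)
open B9SectBCodedCarrierPullbacks (pullF pullH pullRW pullRWK pullC pullPK pullPH pullPK₀)
open B9SectBGpFrameCodedYR (codingYx)
open B9SectBCodedReadingsUR (KSCU KACU)
open B9SectBCodedReadingsUParH (KSCUPar)
open B9SectBCodedChainAnR (IsAnKY)
open B9SectBKerFrameCodedYR (CinvY)
open B6Ineq2142KLevelV1 (β)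
open B9SectBCodedClassGY (C37GY)
open B7Prop2SpecialUnitary (specialUnitaryUnits)
open scoped Matrix.Norms.L2Operator

/-! ## §2. The bundle over the coded carrier as a function of the operator layer, THE TWO SITE TRANSPORTERS `parA`, `parH` AND THE BOND-AVERAGE LETTER `OA` -/

section Bundle

variable {d ℓ : ℕ} {hd : 1 ≤ d + 1} {hL : Odd (ℓ + 1) ∧ 1 < ℓ + 1} {b₀ b₁ : ℝ} {Mstar : ℕ}
variable {𝔸 : Type} [NormedRing 𝔸] [NormedAlgebra ℂ 𝔸] [CompleteSpace 𝔸] (P : RegExtraY d ℓ hd hL b₀ b₁ Mstar 𝔸) (G : Subgroup 𝔸ˣ)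
  {J : Type} (f : J → MemberY d ℓ hd hL b₀ b₁ Mstar) {ι : Type} [Fintype ι] (b : Module.Basis ι ℝ 𝔸)
  (ιB : ∀ j : J, BlkY (f j).toKIdx → IBondY (f j).toKIdx) (C38 : ∀ j : J, ℝ → CfgY 𝔸 (f j).toKIdx → AfldY 𝔸 (f j).toKIdx → Prop)
  (parA parH par : ∀ j : J, SiteParY 𝔸 (f j).toKIdx) (OA : ∀ j : J, BondOpY 𝔸 (f j).toKIdx)
  (ops : ∀ x : MemberY d ℓ hd hL b₀ b₁ Mstar, OperatorLayerY d ℓ hd hL b₀ b₁ Mstar 𝔸 G x)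

/-- ★★★ **THE [B9] CARRIER BUNDLE OVER THE CODED CARRIER, PARAMETRIC IN THE TWO SITE TRANSPORTERS AND THE BOND-AVERAGE LETTER**: `carriersYU` verbatim except
`G′ := KSCUPar … (parA j) (parH j) …` (averaging transporter `parA`, Hölder transporter `parH`), `G := KACU … (OA j) parBY …`,
`C⁻¹ := pullS … (CinvY P f G parA j)`, analyticity `IsAnKY … (parA j) b …` (the averaging family).
[cite: Balaban1985BackgroundPropagators, Thm 3.4 p.400 («extend … as analytic functions of A»), (3.37)–(3.38) p.396, (3.115) p.418, Thms 3.1–3.15 pp.397–432 (the carriers)] -/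
def carriersYUParH : PrintedCarriers9X where
  I9 := J
  d9 := d + 1
  c35 := c35Y
  geo9 := fun j => geo9Y (f j)
  bg9 := fun j => (codingYU P G f ιB C38 j).bg
  InCube := fun j => InCubeY (f j)
  Gp := fun j => KSCUPar P G (f j) (parA j) (parH j) (C37GY G (f j) (ιB j) (cqY d)) (C38 j)
  GA := fun j => KACU P G (f j) (OA j) (parBY (f j).toKIdx) (C37GY G (f j) (ιB j) (cqY d)) (C38 j)
  Cinv := fun j => pullS (codingYU P G f ιB C38 j) (CinvY P f G parA j)
  IsAnalyticExt := fun j => IsAnKY P G (f j) (parA j) b (C37GY G (f j) (ιB j) (cqY d)) (C38 j)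
  E37 := fun j => pullRW (codingYU P G f ιB C38 j) (rwExpansionR (regC335 𝔸 G P) (regC336 𝔸 G P) (ops (f j)).E37)
  EK39 := fun j => pullRWK (codingYU P G f ιB C38 j) (rwKernelExpansionR (regC335 𝔸 G P) (regC336 𝔸 G P) (ops (f j)).EK39)
  E310 := fun j => pullRW (codingYU P G f ιB C38 j) (rwExpansionR (regC335 𝔸 G P) (regC336 𝔸 G P) (ops (f j)).E310)
  PosDef := fun j n => pullC (codingYU P G f ιB C38 j) ((ops (f j)).PosDef n)
  GD := fun j => pullK (codingYU P G f ιB C38 j) (kernelFamilyR (regC335 𝔸 G P) (regC336 𝔸 G P) (ops (f j)).GD)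
  G₁ := fun j => pullK (codingYU P G f ιB C38 j) (kernelFamilyR (regC335 𝔸 G P) (regC336 𝔸 G P) (ops (f j)).G₁)
  H := fun j => pullH (codingYU P G f ιB C38 j) (hKernelR (regC335 𝔸 G P) (regC336 𝔸 G P) (ops (f j)).H)
  H₁ := fun j => pullH (codingYU P G f ιB C38 j) (hKernelR (regC335 𝔸 G P) (regC336 𝔸 G P) (ops (f j)).H₁)
  HasRWExp := fun j => pullPK (codingYU P G f ιB C38 j) (fun K => (ops (f j)).HasRWExp (kernelFamilyRY K))
  HasRWExpH := fun j => pullPH (codingYU P G f ιB C38 j) (fun K => (ops (f j)).HasRWExpH (hKernelRY K))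
  PosDefK := fun j => pullPK₀ (codingYU P G f ιB C38 j) (fun K => (ops (f j)).PosDefK (kernelFamilyRY K))
  GG := fun j => pullK (codingYU P G f ιB C38 j) (kernelFamilyR (regC335 𝔸 G P) (regC336 𝔸 G P) (ops (f j)).GG)
  Kdiff := fun j => pullK (codingYU P G f ιB C38 j) (kernelFamilyR (regC335 𝔸 G P) (regC336 𝔸 G P) (ops (f j)).Kdiff)
  dOmega := fun j => dOmegaY (f j)
  Ck := fun j => pullS (codingYU P G f ιB C38 j) (siteKernelR (regC335 𝔸 G P) (regC336 𝔸 G P) (ops (f j)).Ck)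
  inΛ := fun j => inΛY (f j)
  unitDist := fun j => unitDistY (f j)
  GivenBy3185 := fun j => pullC (codingYU P G f ιB C38 j) (ops (f j)).GivenBy3185
  HasRWExpC := fun j => pullC (codingYU P G f ιB C38 j) (ops (f j)).HasRWExpC
  P349 := fun j => pullF (codingYU P G f ιB C38 j) (fineKernelR (regC335 𝔸 G P) (regC336 𝔸 G P) (ops (f j)).P349)
  QGQinv := fun j => pullS (codingYU P G f ιB C38 j) (siteKernelR (regC335 𝔸 G P) (regC336 𝔸 G P) (ops (f j)).QGQinv)
  QG1Qinv := fun j => pullS (codingYU P G f ιB C38 j) (siteKernelR (regC335 𝔸 G P) (regC336 𝔸 G P) (ops (f j)).QG1Qinv)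
  OmK := fun j => OmKY (f j)

/-- ★ **TODAY's BUNDLE IS THE INSTANCE AT THE SYMMETRIC LETTERS** (`parA = parH := parSymY`, `OA := GAY parSymY parBY (GpY parSymY)`), `rfl`.
[cite: Balaban1985BackgroundPropagators, Thm 3.4 p.400, (3.84)–(3.86) p.407, bookkeeping] -/
theorem carriersYU_eq_carriersYUParH : carriersYU P G f b ιB C38 ops =
    carriersYUParH P G f b ιB C38 (fun j => parSymY (f j).toKIdx) (fun j => parSymY (f j).toKIdx)
      (fun j => GAY (f j).toKIdx (parSymY (f j).toKIdx) (parBY (f j).toKIdx) (GpY (f j).toKIdx (parSymY (f j).toKIdx))) ops := rfl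

/-- ★ **EDITION 1 IS THE DIAGONAL INSTANCE** `parA = parH = par` (`rfl`; dag-n06-c's `KSCU_eq_KSCUPar`). [cite: Balaban1985BackgroundPropagators, Thm 3.4 p.400, (3.21) p.394,
(3.40) p.397, bookkeeping] -/
theorem carriersYUPar_eq_carriersYUParH : carriersYUPar P G f b ιB C38 par OA ops = carriersYUParH P G f b ιB C38 par par OA ops := rfl

/-! ### §2a–§2c. The projections at the parameters (`CarriersYUPar` §2a–§2c re-read; `rfl` ∕ `Iff.rfl`) -/

/-- the index of the bundle is `J`. [cite: Balaban1985BackgroundPropagators, p.399 (the family), bookkeeping] -/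
theorem carriersYUParH_I9 : (carriersYUParH P G f b ιB C38 parA parH OA ops).I9 = J := rfl
/-- the lattice dimension of the bundle is `d + 1`. [cite: Balaban1985BackgroundPropagators, Sect. A p.396, bookkeeping] -/
theorem carriersYUParH_d9 : (carriersYUParH P G f b ιB C38 parA parH OA ops).d9 = d + 1 := rfl
/-- the (3.35) threshold of the bundle is `c35Y`. [cite: Balaban1985BackgroundPropagators, p.396 («≧ 10»), bookkeeping] -/
theorem carriersYUParH_c35 : (carriersYUParH P G f b ιB C38 parA parH OA ops).c35 = c35Y := rfl
/-- … `= 10`. [cite: Balaban1985BackgroundPropagators, p.396 («≧ 10»), bookkeeping] -/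
theorem carriersYUParH_c35_eq : (carriersYUParH P G f b ιB C38 parA parH OA ops).c35 = 10 := rfl
/-- the geometry at `j` is the member `f j`'s. [cite: Balaban1985BackgroundPropagators, Sect. A pp.396–397, bookkeeping] -/
theorem carriersYUParH_geo9 (j : J) : (carriersYUParH P G f b ιB C38 parA parH OA ops).geo9 j = geo9Y (f j) := rfl
/-- **the backgrounds at `j` are the coded carrier of `f j`** at the extended class. [cite: Balaban1985BackgroundPropagators, (3.37)–(3.38) p.396] -/
theorem carriersYUParH_bg9 (j : J) : (carriersYUParH P G f b ιB C38 parA parH OA ops).bg9 j = (codingYU P G f ιB C38 j).bg := rfl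
/-- … spelled through `codingYx`. [cite: Balaban1985BackgroundPropagators, (3.37)–(3.38) p.396, bookkeeping] -/
theorem carriersYUParH_bg9_eq (j : J) : (carriersYUParH P G f b ιB C38 parA parH OA ops).bg9 j = (codingYx P G (f j) (C37GY G (f j) (ιB j) (cqY d)) (C38 j)).bg := rfl
/-- Cor. 3.6's cube predicate at `j` is `InCubeY (f j)`. [cite: Balaban1985BackgroundPropagators, Cor. 3.6 p.408, bookkeeping] -/
theorem carriersYUParH_InCube (j : J) : (carriersYUParH P G f b ιB C38 parA parH OA ops).InCube j = InCubeY (f j) := rfl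
/-- **`G′` at `j` is the U-letter site reading `KSCU` at the transporter parameters `parA j` (averaging), `parH j` (Hölder).** [cite: Balaban1985BackgroundPropagators, Thm 3.4 p.400, (3.42)–(3.47) pp.397–398] -/
theorem carriersYUParH_Gp (j : J) :
    (carriersYUParH P G f b ιB C38 parA parH OA ops).Gp j = KSCUPar P G (f j) (parA j) (parH j) (C37GY G (f j) (ιB j) (cqY d)) (C38 j) := rfl
/-- **`G` at `j` is the U-letter bond reading `KACU`** at the bond-average letter parameter `OA j`, `parBY`. [cite: Balaban1985BackgroundPropagators, Thm 3.4 p.400, (3.84)–(3.86) p.407] -/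
theorem carriersYUParH_GA (j : J) :
    (carriersYUParH P G f b ιB C38 parA parH OA ops).GA j = KACU P G (f j) (OA j)
      (parBY (f j).toKIdx) (C37GY G (f j) (ιB j) (cqY d)) (C38 j) := rfl
/-- `C⁻¹` at `j` is the class-parametric kernel `CinvY P` (`B9SectBKerFrameCodedYR`, bundle `B9SectBCodedChainR4`) at the averaging parameter `parA`, read along the decoding, BY NAME (`rfl`). [cite: Balaban1985BackgroundPropagators, Cor. 3.6 p.408, bookkeeping] -/
theorem carriersYUParH_Cinv (j : J) :
    (carriersYUParH P G f b ιB C38 parA parH OA ops).Cinv j = pullS (codingYU P G f ιB C38 j) (CinvY P f G parA j) := rfl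

/-- FACE: `C⁻¹` at `j` UNFOLDED — the record's (3.48) kernel of the letter `C = CY (parA j) (GpY (parA j))` at the carrier blocks (the `siteKernelOfOp` reading of
`Node00.OpsYOfLetters`, = the body of `CinvY P` at `parA`) read along the decoding (`rfl`). [cite: Balaban1985BackgroundPropagators, Thm 3.2 (3.48) p.398,
Cor. 3.6 p.408, bookkeeping] -/
theorem carriersYUParH_Cinv_eq_siteKernelOfOp (j : J) :
    (carriersYUParH P G f b ιB C38 parA parH OA ops).Cinv j = pullS (codingYU P G f ιB C38 j)
      (siteKernelOfOp (f j).toKIdx (bg9YC 𝔸 G P (f j)) (fun U => U)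
        (CY (f j).toKIdx (parA j) (GpY (f j).toKIdx (parA j)))
        (β (f j).toKIdx.hN (f j).toKIdx.D (f j).toKIdx.hk) (β (f j).toKIdx.hN (f j).toKIdx.D (f j).toKIdx.hk)) := rfl
/-- **the analyticity slot at `j` is `IsAnKY … b`.** [cite: Balaban1985BackgroundPropagators, Thm 3.4 p.400 («extend … as analytic functions of A»)] -/
theorem carriersYUParH_IsAnalyticExt (j : J) :
    (carriersYUParH P G f b ιB C38 parA parH OA ops).IsAnalyticExt j = IsAnKY P G (f j) (parA j) b (C37GY G (f j) (ιB j) (cqY d)) (C38 j) := rfl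
/-- Thm 3.7's expansion at `j` is the record's read along the decoding. [cite: Balaban1985BackgroundPropagators, Thm 3.7 (3.87) p.409, bookkeeping] -/
theorem carriersYUParH_E37 (j : J) : (carriersYUParH P G f b ιB C38 parA parH OA ops).E37 j = pullRW (codingYU P G f ιB C38 j) (rwExpansionR (regC335 𝔸 G P) (regC336 𝔸 G P) (ops (f j)).E37) := rfl
/-- Thm 3.9's kernel expansion at `j` is the record's read along the decoding. [cite: Balaban1985BackgroundPropagators, Thm 3.9 (3.99) p.413, bookkeeping] -/
theorem carriersYUParH_EK39 (j : J) : (carriersYUParH P G f b ιB C38 parA parH OA ops).EK39 j = pullRWK (codingYU P G f ιB C38 j) (rwKernelExpansionR (regC335 𝔸 G P) (regC336 𝔸 G P) (ops (f j)).EK39) := rfl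
/-- Thm 3.10's expansion at `j` is the record's read along the decoding. [cite: Balaban1985BackgroundPropagators, Thm 3.10 pp.415–416, (3.107) p.416, bookkeeping] -/
theorem carriersYUParH_E310 (j : J) : (carriersYUParH P G f b ιB C38 parA parH OA ops).E310 j = pullRW (codingYU P G f ιB C38 j) (rwExpansionR (regC335 𝔸 G P) (regC336 𝔸 G P) (ops (f j)).E310) := rfl
/-- Thm 3.11's positivity slots at `j` are the record's read along the decoding. [cite: Balaban1985BackgroundPropagators, Thm 3.11 p.416, bookkeeping] -/
theorem carriersYUParH_PosDef (j : J) (n : Fin 5) : (carriersYUParH P G f b ιB C38 parA parH OA ops).PosDef j n = pullC (codingYU P G f ιB C38 j) ((ops (f j)).PosDef n) := rfl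
/-- `G(Ω)` (Dirichlet) at `j` is the record's read along the decoding. [cite: Balaban1985BackgroundPropagators, Thm 3.12 p.423, bookkeeping] -/
theorem carriersYUParH_GD (j : J) : (carriersYUParH P G f b ιB C38 parA parH OA ops).GD j = pullK (codingYU P G f ιB C38 j) (kernelFamilyR (regC335 𝔸 G P) (regC336 𝔸 G P) (ops (f j)).GD) := rfl
/-- `G₁` at `j` is the record's read along the decoding. [cite: Balaban1985BackgroundPropagators, (3.134) p.422, bookkeeping] -/
theorem carriersYUParH_G₁ (j : J) : (carriersYUParH P G f b ιB C38 parA parH OA ops).G₁ j = pullK (codingYU P G f ιB C38 j) (kernelFamilyR (regC335 𝔸 G P) (regC336 𝔸 G P) (ops (f j)).G₁) := rfl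
/-- `H` at `j` is the record's read along the decoding. [cite: Balaban1985BackgroundPropagators, (3.133) p.422, bookkeeping] -/
theorem carriersYUParH_H (j : J) : (carriersYUParH P G f b ιB C38 parA parH OA ops).H j = pullH (codingYU P G f ιB C38 j) (hKernelR (regC335 𝔸 G P) (regC336 𝔸 G P) (ops (f j)).H) := rfl
/-- `H₁` at `j` is the record's read along the decoding. [cite: Balaban1985BackgroundPropagators, (3.133) p.422, bookkeeping] -/
theorem carriersYUParH_H₁ (j : J) : (carriersYUParH P G f b ιB C38 parA parH OA ops).H₁ j = pullH (codingYU P G f ιB C38 j) (hKernelR (regC335 𝔸 G P) (regC336 𝔸 G P) (ops (f j)).H₁) := rfl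
/-- «has the random-walk expansion» at `j` is the record's read along the decoding. [cite: Balaban1985BackgroundPropagators, Thm 3.13 p.426, bookkeeping] -/
theorem carriersYUParH_HasRWExp (j : J) : (carriersYUParH P G f b ιB C38 parA parH OA ops).HasRWExp j = pullPK (codingYU P G f ιB C38 j) (fun K => (ops (f j)).HasRWExp (kernelFamilyRY K)) := rfl
/-- «`H` has the random-walk expansion» at `j` is the record's read along the decoding. [cite: Balaban1985BackgroundPropagators, Thm 3.13 p.426, bookkeeping] -/
theorem carriersYUParH_HasRWExpH (j : J) : (carriersYUParH P G f b ιB C38 parA parH OA ops).HasRWExpH j = pullPH (codingYU P G f ιB C38 j) (fun K => (ops (f j)).HasRWExpH (hKernelRY K)) := rfl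
/-- «is positive definite» (on families) at `j` is the record's read along the decoding. [cite: Balaban1985BackgroundPropagators, Thm 3.12 p.423, bookkeeping] -/
theorem carriersYUParH_PosDefK (j : J) : (carriersYUParH P G f b ιB C38 parA parH OA ops).PosDefK j = pullPK₀ (codingYU P G f ιB C38 j) (fun K => (ops (f j)).PosDefK (kernelFamilyRY K)) := rfl
/-- `G(Ω)` (Thm 3.13's family) at `j` is the record's read along the decoding. [cite: Balaban1985BackgroundPropagators, Thm 3.13 p.426, bookkeeping] -/
theorem carriersYUParH_GG (j : J) : (carriersYUParH P G f b ιB C38 parA parH OA ops).GG j = pullK (codingYU P G f ιB C38 j) (kernelFamilyR (regC335 𝔸 G P) (regC336 𝔸 G P) (ops (f j)).GG) := rfl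
/-- Thm 3.14's difference family at `j` is the record's read along the decoding. [cite: Balaban1985BackgroundPropagators, Thm 3.14 p.427, bookkeeping] -/
theorem carriersYUParH_Kdiff (j : J) : (carriersYUParH P G f b ιB C38 parA parH OA ops).Kdiff j = pullK (codingYU P G f ιB C38 j) (kernelFamilyR (regC335 𝔸 G P) (regC336 𝔸 G P) (ops (f j)).Kdiff) := rfl
/-- (3.154) at `j` is `dOmegaY (f j)`. [cite: Balaban1985BackgroundPropagators, (3.154) p.427, bookkeeping] -/
theorem carriersYUParH_dOmega (j : J) : (carriersYUParH P G f b ιB C38 parA parH OA ops).dOmega j = dOmegaY (f j) := rfl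
/-- `C^{(k)}(Λ;U)` at `j` is the record's read along the decoding. [cite: Balaban1985BackgroundPropagators, (3.157) p.428, bookkeeping] -/
theorem carriersYUParH_Ck (j : J) : (carriersYUParH P G f b ιB C38 parA parH OA ops).Ck j = pullS (codingYU P G f ιB C38 j) (siteKernelR (regC335 𝔸 G P) (regC336 𝔸 G P) (ops (f j)).Ck) := rfl
/-- `Λ` at `j` is `inΛY (f j)`. [cite: Balaban1985BackgroundPropagators, p.427 («Λ … is a union of big blocks»), bookkeeping] -/
theorem carriersYUParH_inΛ (j : J) : (carriersYUParH P G f b ιB C38 parA parH OA ops).inΛ j = inΛY (f j) := rfl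
/-- the unit distance at `j` is `unitDistY (f j)`. [cite: Balaban1985BackgroundPropagators, (3.185) p.432, bookkeeping] -/
theorem carriersYUParH_unitDist (j : J) : (carriersYUParH P G f b ιB C38 parA parH OA ops).unitDist j = unitDistY (f j) := rfl
/-- (3.185) at `j` is the record's read along the decoding. [cite: Balaban1985BackgroundPropagators, (3.185) p.432, bookkeeping] -/
theorem carriersYUParH_GivenBy3185 (j : J) : (carriersYUParH P G f b ιB C38 parA parH OA ops).GivenBy3185 j = pullC (codingYU P G f ιB C38 j) (ops (f j)).GivenBy3185 := rfl
/-- (3.186)'s expansion predicate at `j` is the record's read along the decoding. [cite: Balaban1985BackgroundPropagators, (3.186) p.432, bookkeeping] -/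
theorem carriersYUParH_HasRWExpC (j : J) : (carriersYUParH P G f b ιB C38 parA parH OA ops).HasRWExpC j = pullC (codingYU P G f ιB C38 j) (ops (f j)).HasRWExpC := rfl
/-- the (3.49) fine kernel at `j` is the record's read along the decoding. [cite: Balaban1985BackgroundPropagators, (3.49) p.399, bookkeeping] -/
theorem carriersYUParH_P349 (j : J) : (carriersYUParH P G f b ιB C38 parA parH OA ops).P349 j = pullF (codingYU P G f ιB C38 j) (fineKernelR (regC335 𝔸 G P) (regC336 𝔸 G P) (ops (f j)).P349) := rfl
/-- `QGQ*⁻¹` (3.132) at `j` is the record's read along the decoding. [cite: Balaban1985BackgroundPropagators, (3.132) p.422, bookkeeping] -/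
theorem carriersYUParH_QGQinv (j : J) : (carriersYUParH P G f b ιB C38 parA parH OA ops).QGQinv j = pullS (codingYU P G f ιB C38 j) (siteKernelR (regC335 𝔸 G P) (regC336 𝔸 G P) (ops (f j)).QGQinv) := rfl
/-- `QG₁Q*⁻¹` (3.132) at `j` is the record's read along the decoding. [cite: Balaban1985BackgroundPropagators, (3.132) p.422, bookkeeping] -/
theorem carriersYUParH_QG1Qinv (j : J) : (carriersYUParH P G f b ιB C38 parA parH OA ops).QG1Qinv j = pullS (codingYU P G f ιB C38 j) (siteKernelR (regC335 𝔸 G P) (regC336 𝔸 G P) (ops (f j)).QG1Qinv) := rfl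
/-- `Ω_k` at `j` is `OmKY (f j)`. [cite: Balaban1985BackgroundPropagators, Thm 3.14 p.427, bookkeeping] -/
theorem carriersYUParH_OmK (j : J) : (carriersYUParH P G f b ιB C38 parA parH OA ops).OmK j = OmKY (f j) := rfl

/-- the index of the bundle is inhabited when the subfamily's index is. [cite: Balaban1985BackgroundPropagators, p.399 (the family), bookkeeping] -/
theorem carriersYUParH_nonempty_I9 [h : Nonempty J] : Nonempty (carriersYUParH P G f b ιB C38 parA parH OA ops).I9 := h

/-! ### §2b. At a base code the pulled-back carriers read the record's at `U` (`rfl`) -/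

/-- `G(Ω)`'s entries at a base code are the record's at its configuration. [cite: Balaban1985BackgroundPropagators, Thm 3.12 p.423, bookkeeping] -/
theorem carriersYUParH_GD_e_base (j : J) (n : Fin 4) (U : CfgY 𝔸 (f j).toKIdx) :
    ((carriersYUParH P G f b ιB C38 parA parH OA ops).GD j).e n (.base U) = (ops (f j)).GD.e n U := rfl
/-- `G₁`'s entries at a base code are the record's. [cite: Balaban1985BackgroundPropagators, (3.134) p.422, bookkeeping] -/
theorem carriersYUParH_G₁_e_base (j : J) (n : Fin 4) (U : CfgY 𝔸 (f j).toKIdx) :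
    ((carriersYUParH P G f b ιB C38 parA parH OA ops).G₁ j).e n (.base U) = (ops (f j)).G₁.e n U := rfl
/-- `GG`'s entries at a base code are the record's. [cite: Balaban1985BackgroundPropagators, Thm 3.13 p.426, bookkeeping] -/
theorem carriersYUParH_GG_e_base (j : J) (n : Fin 4) (U : CfgY 𝔸 (f j).toKIdx) :
    ((carriersYUParH P G f b ιB C38 parA parH OA ops).GG j).e n (.base U) = (ops (f j)).GG.e n U := rfl
/-- `Kdiff`'s entries at a base code are the record's. [cite: Balaban1985BackgroundPropagators, Thm 3.14 p.427, bookkeeping] -/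
theorem carriersYUParH_Kdiff_e_base (j : J) (n : Fin 4) (U : CfgY 𝔸 (f j).toKIdx) :
    ((carriersYUParH P G f b ιB C38 parA parH OA ops).Kdiff j).e n (.base U) = (ops (f j)).Kdiff.e n U := rfl
/-- `H`'s kernel at a base code is the record's. [cite: Balaban1985BackgroundPropagators, (3.133) p.422, bookkeeping] -/
theorem carriersYUParH_H_h_base (j : J) (U : CfgY 𝔸 (f j).toKIdx) : ((carriersYUParH P G f b ιB C38 parA parH OA ops).H j).h (.base U) = (ops (f j)).H.h U := rfl
/-- `H₁`'s kernel at a base code is the record's. [cite: Balaban1985BackgroundPropagators, (3.133) p.422, bookkeeping] -/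
theorem carriersYUParH_H₁_h_base (j : J) (U : CfgY 𝔸 (f j).toKIdx) : ((carriersYUParH P G f b ιB C38 parA parH OA ops).H₁ j).h (.base U) = (ops (f j)).H₁.h U := rfl
/-- `C^{(k)}(Λ;U)`'s kernel at a base code is the record's. [cite: Balaban1985BackgroundPropagators, (3.157) p.428, bookkeeping] -/
theorem carriersYUParH_Ck_ker_base (j : J) (U : CfgY 𝔸 (f j).toKIdx) : ((carriersYUParH P G f b ιB C38 parA parH OA ops).Ck j).ker (.base U) = (ops (f j)).Ck.ker U := rfl
/-- `QGQ*⁻¹`'s kernel at a base code is the record's. [cite: Balaban1985BackgroundPropagators, (3.132) p.422, bookkeeping] -/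
theorem carriersYUParH_QGQinv_ker_base (j : J) (U : CfgY 𝔸 (f j).toKIdx) : ((carriersYUParH P G f b ιB C38 parA parH OA ops).QGQinv j).ker (.base U) = (ops (f j)).QGQinv.ker U := rfl
/-- `QG₁Q*⁻¹`'s kernel at a base code is the record's. [cite: Balaban1985BackgroundPropagators, (3.132) p.422, bookkeeping] -/
theorem carriersYUParH_QG1Qinv_ker_base (j : J) (U : CfgY 𝔸 (f j).toKIdx) : ((carriersYUParH P G f b ιB C38 parA parH OA ops).QG1Qinv j).ker (.base U) = (ops (f j)).QG1Qinv.ker U := rfl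
/-- the (3.49) fine kernel at a base code is the record's. [cite: Balaban1985BackgroundPropagators, (3.49) p.399, bookkeeping] -/
theorem carriersYUParH_P349_ker_base (j : J) (n : Fin 4) (U : CfgY 𝔸 (f j).toKIdx) :
    ((carriersYUParH P G f b ιB C38 parA parH OA ops).P349 j).ker n (.base U) = (ops (f j)).P349.ker n U := rfl
/-- Thm 3.11's positivity slot at a base code is the record's. [cite: Balaban1985BackgroundPropagators, Thm 3.11 p.416, bookkeeping] -/
theorem carriersYUParH_PosDef_base (j : J) (n : Fin 5) (U : CfgY 𝔸 (f j).toKIdx) : (carriersYUParH P G f b ιB C38 parA parH OA ops).PosDef j n (.base U) = (ops (f j)).PosDef n U := rfl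
/-- (3.185) at a base code is the record's. [cite: Balaban1985BackgroundPropagators, (3.185) p.432, bookkeeping] -/
theorem carriersYUParH_GivenBy3185_base (j : J) (U : CfgY 𝔸 (f j).toKIdx) : (carriersYUParH P G f b ιB C38 parA parH OA ops).GivenBy3185 j (.base U) = (ops (f j)).GivenBy3185 U := rfl
/-- (3.186)'s expansion predicate at a base code is the record's. [cite: Balaban1985BackgroundPropagators, (3.186) p.432, bookkeeping] -/
theorem carriersYUParH_HasRWExpC_base (j : J) (U : CfgY 𝔸 (f j).toKIdx) : (carriersYUParH P G f b ιB C38 parA parH OA ops).HasRWExpC j (.base U) = (ops (f j)).HasRWExpC U := rfl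

/-! ### §2c. The classes of the coded carrier at a base code, unfolded (`Iff.rfl`): what a leaf over the bundle reads as (3.35)–(3.38) -/

/-- the configurations of the coded carrier at `j` are the codes over the member's configurations and the fields `A′`. [cite: Balaban1985BackgroundPropagators, (3.37) p.396 («U′ = exp iηA′»), bookkeeping] -/
theorem carriersYUParH_bg9_Cfg (j : J) : ((carriersYUParH P G f b ιB C38 parA parH OA ops).bg9 j).Cfg = CCfg (CfgY 𝔸 (f j).toKIdx) (AfldY 𝔸 (f j).toKIdx) := rfl
/-- **(3.35) of the coded carrier at a base code READS the parameter's `(«U is G-valued» ∧ P.P₁) ∧ P.P₂` at the member `f j`.** [cite: Balaban1985BackgroundPropagators, (3.35) p.396 («U with values in G … O(1)»)] -/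
theorem carriersYUParH_bg9_Reg335_base_iff (j : J) (c α₀ : ℝ) (U : CfgY 𝔸 (f j).toKIdx) :
    ((carriersYUParH P G f b ιB C38 parA parH OA ops).bg9 j).Reg335 c α₀ (.base U) ↔ (GVal G (f j).toKIdx U ∧ P.P₁ (f j) c α₀ U) ∧ P.P₂ (f j) c α₀ U := Iff.rfl
/-- … i.e. the class-parametric member carrier's (3.35) at `U`. [cite: Balaban1985BackgroundPropagators, (3.35) p.396, bookkeeping] -/
theorem carriersYUParH_bg9_Reg335_base_iff_bg9YC (j : J) (c α₀ : ℝ) (U : CfgY 𝔸 (f j).toKIdx) :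
    ((carriersYUParH P G f b ιB C38 parA parH OA ops).bg9 j).Reg335 c α₀ (.base U) ↔ (bg9YC 𝔸 G P (f j)).Reg335 c α₀ U := Iff.rfl
/-- **(3.36) of the coded carrier at a base code READS the parameter's `(«U is G-valued» ∧ P.Q₁) ∧ P.Q₂` at `f j`.** [cite: Balaban1985BackgroundPropagators, (3.36) p.396] -/
theorem carriersYUParH_bg9_Reg336_base_iff (j : J) (c α₀ : ℝ) (U : CfgY 𝔸 (f j).toKIdx) :
    ((carriersYUParH P G f b ιB C38 parA parH OA ops).bg9 j).Reg336 c α₀ (.base U) ↔ (GVal G (f j).toKIdx U ∧ P.Q₁ (f j) c α₀ U) ∧ P.Q₂ (f j) c α₀ U := Iff.rfl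
/-- no multiplier code `U′` is (3.35)-regular (the classes (3.35)–(3.36) live on the base codes). [cite: Balaban1985BackgroundPropagators, (3.35), (3.37) p.396, bookkeeping] -/
theorem carriersYUParH_bg9_not_Reg335_mult (j : J) (c α₀ : ℝ) (a : AfldY 𝔸 (f j).toKIdx) : ¬ ((carriersYUParH P G f b ιB C38 parA parH OA ops).bg9 j).Reg335 c α₀ (.mult a) := fun h => h
/-- no product code `U′U` is (3.35)-regular. [cite: Balaban1985BackgroundPropagators, (3.35), (3.37) p.396, bookkeeping] -/
theorem carriersYUParH_bg9_not_Reg335_prod (j : J) (c α₀ : ℝ) (U : CfgY 𝔸 (f j).toKIdx) (a : AfldY 𝔸 (f j).toKIdx) :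
    ¬ ((carriersYUParH P G f b ιB C38 parA parH OA ops).bg9 j).Reg335 c α₀ (.prod U a) := fun h => h
/-- **(3.37) of the coded carrier between a base code and a multiplier code READS the extended class `C37GY … (cqY d)`.** [cite: Balaban1985BackgroundPropagators, (3.37) p.396] -/
theorem carriersYUParH_bg9_Cplx337_base_mult_iff (j : J) (α : ℝ) (U : CfgY 𝔸 (f j).toKIdx) (a : AfldY 𝔸 (f j).toKIdx) :
    ((carriersYUParH P G f b ιB C38 parA parH OA ops).bg9 j).Cplx337 α (.base U) (.mult a) ↔ C37GY G (f j) (ιB j) (cqY d) α U a := Iff.rfl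
/-- **(3.38) of the coded carrier between a base code and a multiplier code READS the parameter class `C38 j`.** [cite: Balaban1985BackgroundPropagators, (3.38) p.396] -/
theorem carriersYUParH_bg9_Cplx338_base_mult_iff (j : J) (α : ℝ) (U : CfgY 𝔸 (f j).toKIdx) (a : AfldY 𝔸 (f j).toKIdx) :
    ((carriersYUParH P G f b ιB C38 parA parH OA ops).bg9 j).Cplx338 α (.base U) (.mult a) ↔ C38 j α U a := Iff.rfl
/-- the carrier's product of a multiplier code with a base code is the product code (decoding to `U′U`). [cite: Balaban1985BackgroundPropagators, (3.37) p.396 («U′U»), bookkeeping] -/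
theorem carriersYUParH_bg9_mul_mult_base (j : J) (U : CfgY 𝔸 (f j).toKIdx) (a : AfldY 𝔸 (f j).toKIdx) :
    ((carriersYUParH P G f b ιB C38 parA parH OA ops).bg9 j).mul (.mult a) (.base U) = .prod U a := rfl

end Bundle

/-! ## §3. At the record: `M_N(ℂ)`, `SU(N)` — `Y9OfRecordUParH`, `Y9OfRecordUPbParH` -/

section Record

variable (N : ℕ)

/-- ★★ **THE [B9] CARRIER BUNDLE OF RECORD OVER THE CODED CARRIER, PARAMETRIC IN THE TWO SITE TRANSPORTERS AND THE BOND-AVERAGE LETTER**: `carriersYUParH` at `M_N(ℂ)`, `SU(N)`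
(cf. `Y9OfRecordU`). [cite: Balaban1985BackgroundPropagators, Thm 3.4 p.400, (3.37)–(3.38) p.396, (3.115) p.418, Thms 3.1–3.15 pp.397–432] -/
def Y9OfRecordUParH (θ : Stage3Params) (Mstar : ℕ) (P : RegExtraY θ.d₆ θ.ℓ₆ θ.hd' θ.hL' θ.b₀ θ.b₁ Mstar (Matrix (Fin N) (Fin N) ℂ)) (ops : OpsY N θ Mstar) {J : Type} (f : J → MemberY θ.d₆ θ.ℓ₆ θ.hd' θ.hL' θ.b₀ θ.b₁ Mstar)
    {ι : Type} [Fintype ι] (b : Module.Basis ι ℝ (Matrix (Fin N) (Fin N) ℂ))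
    (ιB : ∀ j : J, BlkY (f j).toKIdx → IBondY (f j).toKIdx)
    (C38 : ∀ j : J, ℝ → CfgY (Matrix (Fin N) (Fin N) ℂ) (f j).toKIdx → AfldY (Matrix (Fin N) (Fin N) ℂ) (f j).toKIdx → Prop)
    (parA parH : ∀ j : J, SiteParY (Matrix (Fin N) (Fin N) ℂ) (f j).toKIdx) (OA : ∀ j : J, BondOpY (Matrix (Fin N) (Fin N) ℂ) (f j).toKIdx) :
    PrintedCarriers9X :=
  carriersYUParH P (specialUnitaryUnits (Fin N)) f b ιB C38 parA parH OA ops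

variable {N}
variable (θ : Stage3Params) (Mstar : ℕ) (P : RegExtraY θ.d₆ θ.ℓ₆ θ.hd' θ.hL' θ.b₀ θ.b₁ Mstar (Matrix (Fin N) (Fin N) ℂ)) (ops : OpsY N θ Mstar) {J : Type} (f : J → MemberY θ.d₆ θ.ℓ₆ θ.hd' θ.hL' θ.b₀ θ.b₁ Mstar)
  {ι : Type} [Fintype ι] (b : Module.Basis ι ℝ (Matrix (Fin N) (Fin N) ℂ))
  (ιB : ∀ j : J, BlkY (f j).toKIdx → IBondY (f j).toKIdx)
  (C38 : ∀ j : J, ℝ → CfgY (Matrix (Fin N) (Fin N) ℂ) (f j).toKIdx → AfldY (Matrix (Fin N) (Fin N) ℂ) (f j).toKIdx → Prop)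
  (parA parH par : ∀ j : J, SiteParY (Matrix (Fin N) (Fin N) ℂ) (f j).toKIdx) (OA : ∀ j : J, BondOpY (Matrix (Fin N) (Fin N) ℂ) (f j).toKIdx)

/-- ★ today's `Y9OfRecordU` IS the instance at the symmetric letters (`rfl`). [cite: Balaban1985BackgroundPropagators, Thm 3.4 p.400, (3.84)–(3.86) p.407, bookkeeping] -/
theorem Y9OfRecordU_eq_Y9OfRecordUParH : Y9OfRecordU N θ Mstar P ops f b ιB C38 =
    Y9OfRecordUParH N θ Mstar P ops f b ιB C38 (fun j => parSymY (f j).toKIdx) (fun j => parSymY (f j).toKIdx)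
      (fun j => GAY (f j).toKIdx (parSymY (f j).toKIdx) (parBY (f j).toKIdx) (GpY (f j).toKIdx (parSymY (f j).toKIdx))) := rfl

/-- ★ edition 1 of record IS the diagonal instance (`rfl`). [cite: Balaban1985BackgroundPropagators, Thm 3.4 p.400, (3.21) p.394, (3.40) p.397, bookkeeping] -/
theorem Y9OfRecordUPar_eq_Y9OfRecordUParH : Y9OfRecordUPar N θ Mstar P ops f b ιB C38 par OA = Y9OfRecordUParH N θ Mstar P ops f b ιB C38 par par OA := rfl

/-- `Y9OfRecordUParH` unfolded (`rfl`). [cite: Balaban1985BackgroundPropagators, Thm 3.4 p.400, bookkeeping] -/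
theorem Y9OfRecordUParH_eq : Y9OfRecordUParH N θ Mstar P ops f b ιB C38 parA parH OA = carriersYUParH P (specialUnitaryUnits (Fin N)) f b ιB C38 parA parH OA ops := rfl
/-- the index of the bundle of record over the coded carrier is `J`. [cite: Balaban1985BackgroundPropagators, p.399, bookkeeping] -/
theorem Y9OfRecordUParH_I9 : (Y9OfRecordUParH N θ Mstar P ops f b ιB C38 parA parH OA).I9 = J := rfl
/-- … inhabited when `J` is. [cite: Balaban1985BackgroundPropagators, p.399, bookkeeping] -/
theorem Y9OfRecordUParH_nonempty_I9 [h : Nonempty J] : Nonempty (Y9OfRecordUParH N θ Mstar P ops f b ιB C38 parA parH OA).I9 := h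
/-- **the backgrounds of record over the coded carrier at `j`** = the coding of `bg9Y (M_N(ℂ)) SU(N) (f j)` at the extended class. [cite: Balaban1985BackgroundPropagators, (3.37)–(3.38) p.396] -/
theorem Y9OfRecordUParH_bg9 (j : J) : (Y9OfRecordUParH N θ Mstar P ops f b ιB C38 parA parH OA).bg9 j = (codingYU P (specialUnitaryUnits (Fin N)) f ιB C38 j).bg := rfl
/-- **`G′` of record over the coded carrier at `j`** = `KSCUPar` at `SU(N)`, `parA j`, `parH j`. [cite: Balaban1985BackgroundPropagators, Thm 3.4 p.400] -/
theorem Y9OfRecordUParH_Gp (j : J) : (Y9OfRecordUParH N θ Mstar P ops f b ιB C38 parA parH OA).Gp j =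
    KSCUPar P (specialUnitaryUnits (Fin N)) (f j) (parA j) (parH j) (C37GY (specialUnitaryUnits (Fin N)) (f j) (ιB j) (cqY θ.d₆)) (C38 j) := rfl
/-- **`G` of record over the coded carrier at `j`** = `KACU` at `SU(N)`, `OA j`, `parBY`. [cite: Balaban1985BackgroundPropagators, Thm 3.4 p.400] -/
theorem Y9OfRecordUParH_GA (j : J) : (Y9OfRecordUParH N θ Mstar P ops f b ιB C38 parA parH OA).GA j =
    KACU P (specialUnitaryUnits (Fin N)) (f j) (OA j)
      (parBY (f j).toKIdx) (C37GY (specialUnitaryUnits (Fin N)) (f j) (ιB j) (cqY θ.d₆)) (C38 j) := rfl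
/-- `C⁻¹` of record over the coded carrier at `j` = `CinvY P` read along the decoding (by name, `rfl`). [cite: Balaban1985BackgroundPropagators, Cor. 3.6 p.408,
bookkeeping] -/
theorem Y9OfRecordUParH_Cinv (j : J) : (Y9OfRecordUParH N θ Mstar P ops f b ιB C38 parA parH OA).Cinv j =
    pullS (codingYU P (specialUnitaryUnits (Fin N)) f ιB C38 j) (CinvY P f (specialUnitaryUnits (Fin N)) parA j) := rfl
/-- **the analyticity slot of record over the coded carrier at `j`** = `IsAnKY … b`. [cite: Balaban1985BackgroundPropagators, Thm 3.4 p.400] -/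
theorem Y9OfRecordUParH_IsAnalyticExt (j : J) : (Y9OfRecordUParH N θ Mstar P ops f b ιB C38 parA parH OA).IsAnalyticExt j =
    IsAnKY P (specialUnitaryUnits (Fin N)) (f j) (parA j) b (C37GY (specialUnitaryUnits (Fin N)) (f j) (ιB j) (cqY θ.d₆)) (C38 j) := rfl
/-- `G(Ω)` of record over the coded carrier at `j` = the operator layer's read along the decoding. [cite: Balaban1985BackgroundPropagators, Thm 3.12 p.423, bookkeeping] -/
theorem Y9OfRecordUParH_GD (j : J) : (Y9OfRecordUParH N θ Mstar P ops f b ιB C38 parA parH OA).GD j =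
    pullK (codingYU P (specialUnitaryUnits (Fin N)) f ιB C38 j) (kernelFamilyR (regC335 (Matrix (Fin N) (Fin N) ℂ) (specialUnitaryUnits (Fin N)) P) (regC336 (Matrix (Fin N) (Fin N) ℂ) (specialUnitaryUnits (Fin N)) P) (ops (f j)).GD) := rfl
/-- `C^{(k)}(Λ;U)` of record over the coded carrier at `j` = the operator layer's read along the decoding. [cite: Balaban1985BackgroundPropagators, (3.157) p.428, bookkeeping] -/
theorem Y9OfRecordUParH_Ck (j : J) : (Y9OfRecordUParH N θ Mstar P ops f b ιB C38 parA parH OA).Ck j =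
    pullS (codingYU P (specialUnitaryUnits (Fin N)) f ιB C38 j) (siteKernelR (regC335 (Matrix (Fin N) (Fin N) ℂ) (specialUnitaryUnits (Fin N)) P) (regC336 (Matrix (Fin N) (Fin N) ℂ) (specialUnitaryUnits (Fin N)) P) (ops (f j)).Ck) := rfl
/-- (3.185) of record over the coded carrier at `j` = the operator layer's read along the decoding. [cite: Balaban1985BackgroundPropagators, (3.185) p.432, bookkeeping] -/
theorem Y9OfRecordUParH_GivenBy3185 (j : J) :
    (Y9OfRecordUParH N θ Mstar P ops f b ιB C38 parA parH OA).GivenBy3185 j = pullC (codingYU P (specialUnitaryUnits (Fin N)) f ιB C38 j) (ops (f j)).GivenBy3185 := rfl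

/-! ### §3a. The geometric fields agree with the record bundle `Y9OfRecordP` along `f` (`rfl`) -/

/-- the geometry of record over the coded carrier at `j` is the record bundle's at `f j`. [cite: Balaban1985BackgroundPropagators, Sect. A pp.396–397, bookkeeping] -/
theorem Y9OfRecordUParH_geo9 (j : J) : (Y9OfRecordUParH N θ Mstar P ops f b ιB C38 parA parH OA).geo9 j = (Y9OfRecordP N θ Mstar ops).geo9 (f j) := rfl
/-- the cube predicate agrees along `f`. [cite: Balaban1985BackgroundPropagators, Cor. 3.6 p.408, bookkeeping] -/
theorem Y9OfRecordUParH_InCube (j : J) : (Y9OfRecordUParH N θ Mstar P ops f b ιB C38 parA parH OA).InCube j = (Y9OfRecordP N θ Mstar ops).InCube (f j) := rfl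
/-- (3.154) agrees along `f`. [cite: Balaban1985BackgroundPropagators, (3.154) p.427, bookkeeping] -/
theorem Y9OfRecordUParH_dOmega (j : J) : (Y9OfRecordUParH N θ Mstar P ops f b ιB C38 parA parH OA).dOmega j = (Y9OfRecordP N θ Mstar ops).dOmega (f j) := rfl
/-- `Λ` agrees along `f`. [cite: Balaban1985BackgroundPropagators, p.427, bookkeeping] -/
theorem Y9OfRecordUParH_inΛ (j : J) : (Y9OfRecordUParH N θ Mstar P ops f b ιB C38 parA parH OA).inΛ j = (Y9OfRecordP N θ Mstar ops).inΛ (f j) := rfl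
/-- the unit distance agrees along `f`. [cite: Balaban1985BackgroundPropagators, (3.185) p.432, bookkeeping] -/
theorem Y9OfRecordUParH_unitDist (j : J) : (Y9OfRecordUParH N θ Mstar P ops f b ιB C38 parA parH OA).unitDist j = (Y9OfRecordP N θ Mstar ops).unitDist (f j) := rfl
/-- `Ω_k` agrees along `f`. [cite: Balaban1985BackgroundPropagators, Thm 3.14 p.427, bookkeeping] -/
theorem Y9OfRecordUParH_OmK (j : J) : (Y9OfRecordUParH N θ Mstar P ops f b ιB C38 parA parH OA).OmK j = (Y9OfRecordP N θ Mstar ops).OmK (f j) := rfl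
/-- the (3.35) threshold agrees (`= 10`). [cite: Balaban1985BackgroundPropagators, p.396 («≧ 10»), bookkeeping] -/
theorem Y9OfRecordUParH_c35 : (Y9OfRecordUParH N θ Mstar P ops f b ιB C38 parA parH OA).c35 = (Y9OfRecordP N θ Mstar ops).c35 := rfl
/-- the lattice dimension agrees. [cite: Balaban1985BackgroundPropagators, Sect. A p.396, bookkeeping] -/
theorem Y9OfRecordUParH_d9 : (Y9OfRecordUParH N θ Mstar P ops f b ιB C38 parA parH OA).d9 = (Y9OfRecordP N θ Mstar ops).d9 := rfl

/-- **(3.35) of the bundle of record over the coded carrier at a base code READS the parameter's conjunction at `f j`.** [cite: Balaban1985BackgroundPropagators, (3.35) p.396] -/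
theorem Y9OfRecordUParH_bg9_Reg335_base_iff (j : J) (c α₀ : ℝ) (U : CfgY (Matrix (Fin N) (Fin N) ℂ) (f j).toKIdx) :
    ((Y9OfRecordUParH N θ Mstar P ops f b ιB C38 parA parH OA).bg9 j).Reg335 c α₀ (.base U) ↔
      (GVal (specialUnitaryUnits (Fin N)) (f j).toKIdx U ∧ P.P₁ (f j) c α₀ U) ∧ P.P₂ (f j) c α₀ U := Iff.rfl

/-! ### §3b. At the record's reading of print's class: `P := extraYPb` -/

variable (N) in
/-- ★★ **THE PARAMETRIC BUNDLE OF RECORD AT THE RECORD's READING OF PRINT's CLASS (3.35)–(3.36)** (`P := extraYPb (M_N ℂ) SU(N)`; cf. `Y9OfRecordUPb`): NAMES the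
class instance; asserts nothing about it. [cite: Balaban1985BackgroundPropagators, (3.35)–(3.36) p.396 («O(1) … a number ≧ 10»), Thm 3.4 p.400] -/
def Y9OfRecordUPbParH : PrintedCarriers9X :=
  Y9OfRecordUParH N θ Mstar (extraYPb (Matrix (Fin N) (Fin N) ℂ) (specialUnitaryUnits (Fin N))) ops f b ιB C38 parA parH OA

/-- `Y9OfRecordUPbParH` unfolded (`rfl`). [cite: Balaban1985BackgroundPropagators, (3.35) p.396, bookkeeping] -/
theorem Y9OfRecordUPbParH_eq :
    Y9OfRecordUPbParH N θ Mstar ops f b ιB C38 parA parH OA = Y9OfRecordUParH N θ Mstar (extraYPb (Matrix (Fin N) (Fin N) ℂ) (specialUnitaryUnits (Fin N))) ops f b ιB C38 parA parH OA := rfl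
/-- … through `carriersYUParH`. [cite: Balaban1985BackgroundPropagators, (3.35) p.396, bookkeeping] -/
theorem Y9OfRecordUPbParH_eq_carriersYUParH : Y9OfRecordUPbParH N θ Mstar ops f b ιB C38 parA parH OA =
    carriersYUParH (extraYPb (Matrix (Fin N) (Fin N) ℂ) (specialUnitaryUnits (Fin N))) (specialUnitaryUnits (Fin N)) f b ιB C38 parA parH OA ops := rfl
/-- the index of the bundle is `J`. [cite: Balaban1985BackgroundPropagators, p.399, bookkeeping] -/
theorem Y9OfRecordUPbParH_I9 : (Y9OfRecordUPbParH N θ Mstar ops f b ιB C38 parA parH OA).I9 = J := rfl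
/-- … inhabited when `J` is. [cite: Balaban1985BackgroundPropagators, p.399, bookkeeping] -/
theorem Y9OfRecordUPbParH_nonempty_I9 [h : Nonempty J] : Nonempty (Y9OfRecordUPbParH N θ Mstar ops f b ιB C38 parA parH OA).I9 := h
/-- **(3.35) of the bundle at the record's reading, at a base code, SPELLED OUT**: «`U` is `SU(N)`-valued», «`0 ≤ α₀`» and print's cube condition (3.35) at threshold `10` and
`M·α₀` at the member's index, and MODULE 2-P's (3.35) at the second pin. [cite: Balaban1985BackgroundPropagators, (3.35) p.396 («|U(∂p) − 1| < α₀ M … O(1)»)] -/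
theorem Y9OfRecordUPbParH_bg9_Reg335_base_iff (j : J) (c α₀ : ℝ) (U : CfgY (Matrix (Fin N) (Fin N) ℂ) (f j).toKIdx) :
    ((Y9OfRecordUPbParH N θ Mstar ops f b ιB C38 parA parH OA).bg9 j).Reg335 c α₀ (.base U) ↔
      (GVal (specialUnitaryUnits (Fin N)) (f j).toKIdx U ∧
          (0 ≤ α₀ ∧ B9BackgroundsKLevelV1P.Reg335PC (Matrix (Fin N) (Fin N) ℂ) (f j).toKIdx (B9BackgroundsKLevelV1P.cubeClassP (f j).toKIdx c35Y)
            ((B6KLevelCensusIndexV1.kGeo (f j).toKIdx).M * α₀) U)) ∧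
        (bg9KP (Matrix (Fin N) (Fin N) ℂ) (specialUnitaryUnits (Fin N)) (f j).snd).Reg335 c35Y α₀ U := Iff.rfl
/-- **(3.36) of the bundle at the record's reading, at a base code, SPELLED OUT** likewise. [cite: Balaban1985BackgroundPropagators, (3.36) p.396] -/
theorem Y9OfRecordUPbParH_bg9_Reg336_base_iff (j : J) (c α₀ : ℝ) (U : CfgY (Matrix (Fin N) (Fin N) ℂ) (f j).toKIdx) :
    ((Y9OfRecordUPbParH N θ Mstar ops f b ιB C38 parA parH OA).bg9 j).Reg336 c α₀ (.base U) ↔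
      (GVal (specialUnitaryUnits (Fin N)) (f j).toKIdx U ∧
          (0 ≤ α₀ ∧ B9BackgroundsKLevelV1P.Reg336PC (Matrix (Fin N) (Fin N) ℂ) (f j).toKIdx (B9BackgroundsKLevelV1P.cubeClassP (f j).toKIdx c35Y)
            ((B6KLevelCensusIndexV1.kGeo (f j).toKIdx).M * α₀) U)) ∧
        (bg9KP (Matrix (Fin N) (Fin N) ℂ) (specialUnitaryUnits (Fin N)) (f j).snd).Reg336 c35Y α₀ U := Iff.rfl
/-- the geometric fields of the bundle at the record's reading agree with `Y9OfRecordP`'s along `f` (`rfl`). [cite: Balaban1985BackgroundPropagators, Sect. A pp.396–397, bookkeeping] -/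
theorem Y9OfRecordUPbParH_geo9 (j : J) : (Y9OfRecordUPbParH N θ Mstar ops f b ιB C38 parA parH OA).geo9 j = (Y9OfRecordP N θ Mstar ops).geo9 (f j) := rfl

/-- ★ today's `Y9OfRecordUPb` IS the instance at the symmetric letters (`rfl`). [cite: Balaban1985BackgroundPropagators, Thm 3.4 p.400, (3.84)–(3.86) p.407, bookkeeping] -/
theorem Y9OfRecordUPb_eq_Y9OfRecordUPbParH : Y9OfRecordUPb N θ Mstar ops f b ιB C38 =
    Y9OfRecordUPbParH N θ Mstar ops f b ιB C38 (fun j => parSymY (f j).toKIdx) (fun j => parSymY (f j).toKIdx)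
      (fun j => GAY (f j).toKIdx (parSymY (f j).toKIdx) (parBY (f j).toKIdx) (GpY (f j).toKIdx (parSymY (f j).toKIdx))) := rfl

/-- ★ edition 1 at the record's class IS the diagonal instance (`rfl`). [cite: Balaban1985BackgroundPropagators, Thm 3.4 p.400, (3.35) p.396, bookkeeping] -/
theorem Y9OfRecordUPbPar_eq_Y9OfRecordUPbParH : Y9OfRecordUPbPar N θ Mstar ops f b ιB C38 par OA = Y9OfRecordUPbParH N θ Mstar ops f b ιB C38 par par OA := rfl

end Record

end Literature.MathematicalPhysics.QuantumFieldTheory.Balaban1983to89.Node00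

end
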